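import Summits.RiemannHypothesis.RiemannHypothesis.Theses.RuelleBand
import Literature.NumberTheory.LFunctions.WeilCriterionConverse
import HarnessLib.Audit

/-! # Line `SketchIdeator1` (even Weil sector), stub 2: evenness ⟹ the zero-side exponential sum is real and even

Crux `RuelleBand.ExactFirstBand` (stmt-RiemannHypothesis-2061), line `SketchIdeator1`, stub `stub_evenExpSum`.
For an EVEN function `g : ℝ → ℂ` (`g(-t) = g(t)`), in the tree's additive `1/2`-symmetric normalisation
`ĝ(s) = ∫ g(t) e^{(s-1/2)t} dt` (`Literature.NumberTheory.LFunctions.weilMellin`):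

* `ĝ(1 - s) = ĝ(s)` for every `s` (substitute `t ↦ -t`, `integral_neg_eq_self`; no integrability needed);
* hence `P_g(1 - ρ) = P_g(ρ)` for the zero-side pairing `P_g(ρ) = ĝ(ρ) conj ĝ(1 - ρ̄)`
  (`WeilConverse.pairCoeff`), and re-indexing the generalised Dirichlet series
  `B_g(x) = Σ_ρ m(ρ) P_g(ρ) e^{(ρ-1/2)x}` (`WeilConverse.expSum`) by the involution `ρ ↦ 1 - ρ` of the
  non-trivial zeros (which preserves multiplicities, `riemannZetaZeroOrder_one_sub_holds`) gives
  `B_g(-y) = B_g(y)`;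
* `conj B_g(y) = A_g(y) = B_g(-y)` (`WeilConverse.conj_expSum'` and the termwise identity
  `e^{(1/2-ρ)y} = e^{(ρ-1/2)(-y)}`), so `B_g(y)` is real.
-/

noncomputable section
open Complex MeasureTheory Filter Set
open scoped Real Topology ComplexConjugate
namespace Summit.RiemannHypothesis.RiemannHypothesis.Theorems.RuelleBandExactFirstBand
open Literature.NumberTheory.LFunctions

/-- **Evenness of the transform.** For an even `g`, `ĝ(1 - s) = ĝ(s)` for every `s : ℂ`: substitute
`t ↦ -t` (`integral_neg_eq_self`, Lebesgue measure is negation invariant) and use `g(-t) = g(t)`,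
`(1 - s - 1/2)(-t) = (s - 1/2)t`. No hypotheses on `g` beyond evenness (both sides are the junk value `0`
when the integrals diverge). -/
theorem weilMellin_one_sub_of_even {g : ℝ → ℂ} (hev : ∀ t : ℝ, g (-t) = g t) (s : ℂ) :
    weilMellin g (1 - s) = weilMellin g s := by
  unfold weilMellin
  have h := integral_neg_eq_self
    (fun t : ℝ ↦ g (-t) * cexp ((1 - s - 1 / 2) * ((-t : ℝ) : ℂ))) volume
  simp only [neg_neg] at h
  rw [h]
  congr 1 with t
  rw [hev t]
  congr 1
  push_cast
  ring

/-- **Reflection symmetry of the pairing.** For an even `g`, `P_g(1 - ρ) = P_g(ρ)`: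
`P_g(1-ρ) = ĝ(1-ρ) conj ĝ(1 - conj (1-ρ)) = ĝ(ρ) conj ĝ(conj ρ)` and
`P_g(ρ) = ĝ(ρ) conj ĝ(1 - conj ρ) = ĝ(ρ) conj ĝ(conj ρ)` by `weilMellin_one_sub_of_even`. -/
theorem pairCoeff_one_sub_of_even {g : ℝ → ℂ} (hev : ∀ t : ℝ, g (-t) = g t) (ρ : ℂ) :
    WeilConverse.pairCoeff g (1 - ρ) = WeilConverse.pairCoeff g ρ := by
  have h1 : 1 - conj (1 - ρ) = conj ρ := by simp
  rw [WeilConverse.pairCoeff, WeilConverse.pairCoeff, h1, weilMellin_one_sub_of_even hev ρ,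
    weilMellin_one_sub_of_even hev (conj ρ)]

/-- **`B_g` is even for even `g`.** Re-index `B_g(-y)` by the permutation `ρ ↦ 1 - ρ` of the non-trivial
zeros (an involution; membership by `one_sub_conj_mem` and `conj_mem`, since `conj (1 - conj ρ) = 1 - ρ`;
`Function.Involutive.toPerm`, `Equiv.tsum_eq`): multiplicities agree (`riemannZetaZeroOrder_one_sub_holds`),
the pairings agree (`pairCoeff_one_sub_of_even`), and `((1-ρ) - 1/2)(-y) = (ρ - 1/2)y`. -/
theorem expSum_neg_of_even {g : ℝ → ℂ} (hev : ∀ t : ℝ, g (-t) = g t) (y : ℝ) :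
    WeilConverse.expSum g (-y) = WeilConverse.expSum g y := by
  have hinv : Function.Involutive fun ρ : ZetaZeros.riemannZetaNontrivialZeros ↦
      (⟨1 - (ρ : ℂ), by
        simpa using ZetaZeros.riemannZetaNontrivialZeros.conj_mem
          (ZetaZeros.riemannZetaNontrivialZeros.one_sub_conj_mem ρ.2)⟩ :
        ZetaZeros.riemannZetaNontrivialZeros) :=
    fun ρ ↦ Subtype.ext (by simp)
  rw [WeilConverse.expSum, WeilConverse.expSum, ← Equiv.tsum_eq (hinv.toPerm _)]
  refine tsum_congr fun σ ↦ ?_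
  have h0 := ZetaZeros.riemannZetaNontrivialZeros.re_pos σ.2
  have h1 := ZetaZeros.riemannZetaNontrivialZeros.re_lt_one σ.2
  have hm : riemannZetaZeroOrder (1 - (σ : ℂ)) = riemannZetaZeroOrder (σ : ℂ) :=
    riemannZetaZeroOrder_one_sub_holds h0 h1
  have hE : cexp ((1 - (σ : ℂ) - 1 / 2) * ((-y : ℝ) : ℂ)) = cexp (((σ : ℂ) - 1 / 2) * (y : ℂ)) := by
    congr 1
    push_cast
    ring
  show (riemannZetaZeroOrder (1 - (σ : ℂ)) : ℂ) * WeilConverse.pairCoeff g (1 - (σ : ℂ)) *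
      cexp ((1 - (σ : ℂ) - 1 / 2) * ((-y : ℝ) : ℂ)) = _
  rw [hm, pairCoeff_one_sub_of_even hev, hE]

/-- `A_g(y) = B_g(-y)` termwise: `e^{(1/2-ρ)y} = e^{(ρ-1/2)(-y)}` (no hypothesis on `g`). -/
theorem expSum'_eq_expSum_neg (g : ℝ → ℂ) (y : ℝ) :
    WeilConverse.expSum' g y = WeilConverse.expSum g (-y) := by
  rw [WeilConverse.expSum', WeilConverse.expSum]
  refine tsum_congr fun ρ ↦ ?_
  congr 2
  push_cast
  ring

/-- `conj B_g(y) = B_g(-y)` for every `g` (`conj_expSum'` conjugated, then `expSum'_eq_expSum_neg`). -/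
theorem conj_expSum_eq_expSum_neg (g : ℝ → ℂ) (y : ℝ) :
    conj (WeilConverse.expSum g y) = WeilConverse.expSum g (-y) := by
  rw [← WeilConverse.conj_expSum' g y, Complex.conj_conj, expSum'_eq_expSum_neg]

/-- **Stub 2 of line `SketchIdeator1` — evenness makes the zero-side exponential sum real and even.** For
an EVEN test function `g` (`g(-t) = g(t)`): `ĝ(1-s) = ĝ(s)` (`weilMellin_one_sub_of_even`), hence
`P_g(1-ρ) = P_g(ρ)`; re-indexing `B_g` by the permutation `ρ ↦ 1-ρ` of the non-trivial zeros
(`one_sub_conj_mem` ∘ `conj_mem`, multiplicities by `riemannZetaZeroOrder_one_sub_holds`) gives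
`B_g(-y) = B_g(y)` (`expSum_neg_of_even`), and with `conj B_g(y) = B_g(-y)` (`conj_expSum'`) the values
`B_g(y)` are real (`Complex.conj_eq_iff_im`). The test-function hypothesis is not used. -/
theorem stub_evenExpSum :
    ∀ (g : ℝ → ℂ), IsWeilTest g → (∀ t : ℝ, g (-t) = g t) →
      (∀ s : ℂ, weilMellin g (1 - s) = weilMellin g s) ∧
      ∀ y : ℝ, WeilConverse.expSum g (-y) = WeilConverse.expSum g y ∧ (WeilConverse.expSum g y).im = 0 := by
  intro g _ hev
  refine ⟨weilMellin_one_sub_of_even hev, fun y ↦ ⟨expSum_neg_of_even hev y, ?_⟩⟩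
  rw [← Complex.conj_eq_iff_im, conj_expSum_eq_expSum_neg, expSum_neg_of_even hev]

end Summit.RiemannHypothesis.RiemannHypothesis.Theorems.RuelleBandExactFirstBand
end
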